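import Mathlib
import Literature.MathematicalPhysics.QuantumFieldTheory.Balaban1983to89.B16Sect1Kernels

/-!
# `Balaban1983to89.B16Sect1Statements` — T. Bałaban, *Large field renormalization. II. Localization, exponentiation,
and bounds for the 𝐑 operation*, Commun. Math. Phys. **122**, 355–392 (1989) [Balaban1989LargeFieldII] (cell paper
B16; PDF held `paper:balaban1989-cmp122-large-field-ii`, journal page = PDF page + 354): the IN-TEXT BOUNDS of §1
pp. 358–369 and pp. 379–383 that the first two modules of the block (`…B16Sect1Wilson`, `…B16Sect1Kernels`) left at
reader level — the unnumbered lemma-like statements of pp. 358, 366, 369, 379, 381–382 (SKELETON rows B16.Lem@358,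
B16.Lem@366, B16.Def@369, B16.Lem@379, B16.Lem@381) and the displayed / in-line bounds (1.20) (third-order term and
small quadratic terms, p. 361), (1.23), (1.24) (second term), (1.27), (1.28), (1.29) (the two boundary-layer sums,
p. 363), (1.41), (1.45), (1.47) — typed at statement level (mega-formalization `lit-balaban`, reader/typer block r13,
third module, generation 2; stem reserved in `SHARED-STRUCTURES.md` §4).

Statement-level skeleton of published theorems with citation tags; proofs where landed; nothing here is a claim about the Yang–Mills mass gap.

WHAT IS HERE.  Every bound is a `Prop` over real parameters NAMED AS PRINTED (`εk` = ε_k, `δ'k` = δ′_k, `p₀g` =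
p₀(g_k), `Rk` = R_k, `Rh1` = R_{h+1}, `cardB₀` = |𝐁₀|, …; each printed `O(1)` is an explicit constant `C`, `C'`, …;
real powers `N^{β₀}`, `R_k^{β₀}`, `R_j^{1+β₀}` are `Real.rpow`), the bounded quantity entering as a real number (`T`,
`V`, `Q`, `σ₁`, … = the value, or the norm, of the term the text bounds).  Wherever the text performs ARITHMETIC on
such a bound (a chain `≤ … ≤ …` using `|𝐁₀| ≦ (100MR_k)^dN²`, `N ≦ R_k`, `ε_k = g_kA₀p₀(g_k)`, `δ′_k = g_kA₁p₁(g_k)`,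
`α_{0,k} + α_{1,k} ≦ C₀g_kq₀(g_k)`, `R_{h+1} ≦ O(1)N^{β₀}R_k`, `L^hη = L^{−N}`, or the relations among the constants
`A₀, A₁, B₃, M, γ₀` that the text uses silently on p. 381 — cell ledger GAPS G-B16-07 R2–R4), that arithmetic is
PROVED here with the inputs as explicit hypotheses (`…_arith`, `…_chain`, `prep381_…`, `prep382_…`); nothing else is
asserted.  The objects themselves (minimizers `U_{k,Z}`, `U⁰_{k,Z}`, propagators `H″_{1,k,Z}`, `𝐇_{𝐁₁}`, the
random-walk expansion (1.26), the boundary terms summed in `𝐂_k`) stay abstract: the tree carries them only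
schematically (cell DIVERGENCE "schematic typing"), so the functional IDENTITIES (1.16), (1.19), (1.22), (1.24)–(1.26),
(1.29), (1.46), (1.48) remain inventory rows of `HOME/lit-balaban-r13/ROWS-B16.md`, not declarations.

Every quotation below was re-read by this seat on the page renders
`run/shared/lean/pub/pub-balaban/b2b-balaban-ref1/pages/1989-cmp122-large-field-II/` p004, p007, p008, p009, p012,
p013, p014, p015, p025, p027, p028, p029 (journal pp. 358, 361–363, 366–369, 379, 381–383); the cell transcript
`run/shared/lean/pub/pub-balaban/b2b-balaban-b02/B16-transcript.md` was used only to locate them.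
-/

namespace Literature.MathematicalPhysics.QuantumFieldTheory.Balaban1983to89.B16Sect1Statements

open Literature.MathematicalPhysics.QuantumFieldTheory.Balaban1983to89
open Finset

/-! ## §1. p. 358: the denominator of (1.1) is bounded from below (SKELETON row B16.Lem@358) -/

/-- **p. 358 [4], the lower bound of the `B′`-integral of (1.2)** (render p004), verbatim: *"It allows us to prove
Proposition 1 [IV], but at first we estimate the integral on the right-hand side of (1.2). This integral is in the
denominator of (1.1), hence we are interested only in a lower bound, which follows from the boundedness of the
quadratic form. The integral is bounded from below by exp(−O(1)|Λ|) = exp(−O(M⁴)). In fact, we need such a bound for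
the integral extended analytically on Gᶜ-valued configurations 𝐔. We construct such an extension replacing the
variables V_k in the function U₀ by the averages M^k(𝐔) for 𝐔 ∈ U^c_k(Z, α_{0,k}, α_{1,k}). The expressions in the
integral are analytic functions of 𝐔, and all the bounds above hold with ε_k replaced by O(α_{0,k} + α_{1,k})."* — the
claim as a `Prop` on the value `I` of the integral (`volΛ` = `|Λ|`, the `O(1)` an explicit `C`); no derivation is
displayed in print (cell transcript: routine Gaussian lower bound from (1.6), (1.9) and the `V`-term). [cite: Balaban1989LargeFieldII, p.358 (before (1.10))] -/
def DenomLower358 (I C volΛ : ℝ) : Prop :=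
  Real.exp (-(C * volΛ)) ≤ I

/-- The printed rewriting `exp(−O(1)|Λ|) = exp(−O(M⁴))`, PROVED as the inequality it is used as: `Λ` lies in a cube
of size `100M` (p. 357), so `|Λ| ≤ (100M)⁴` (`d = 4`) and `exp(−(C·100⁴)M⁴) ≤ exp(−C|Λ|) ≤ I`. [cite: Balaban1989LargeFieldII, p.358 (before (1.10))] -/
theorem denomLower358_M4 {I C volΛ M : ℝ} (hC : 0 ≤ C) (hvol : volΛ ≤ (100 * M) ^ 4)
    (h : DenomLower358 I C volΛ) : Real.exp (-(C * 100 ^ 4 * M ^ 4)) ≤ I := by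
  unfold DenomLower358 at h
  refine le_trans (Real.exp_le_exp.mpr ?_) h
  have h1 : C * volΛ ≤ C * (100 * M) ^ 4 := mul_le_mul_of_nonneg_left hvol hC
  have h2 : C * (100 * M) ^ 4 = C * 100 ^ 4 * M ^ 4 := by ring
  linarith

/-! ## §2. p. 361: the third-order term of (1.20) and the small terms of its quadratic form (row B16.Eq1.20) -/

/-- **(1.20), the `V`-term** p. 361 [7] (render p007), verbatim: *"The last term above is at least of third order in
g_kB, therefore it is small after dividing by g_k². Notice that this time bounds are a bit more difficult and larger,
because of the many scales in the definitions of the operators and the field B. Thus the last term is bounded by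
O(1)|𝐁₀|δ′_k³ ≦ O(1)(100MR_k)^dN²δ′_k³ ≦ g_k³O(1)M^dR_k^{d+2}A₁³p₁³(g_k), and dividing the number on the right-hand
side by g_k² we get still a small number, if g_k is small enough. We have assumed here that N ≦ R_k."* — the first
inequality as a `Prop` on the value `V` of the term `V(ζ, g_kH″_{1,k,Z}B)` (`cardB₀` = `|𝐁₀|`, the number of bond
variables of the multi-scale set `𝐁₀` of [IV] §1). [cite: Balaban1989LargeFieldII, (1.20) p.361] -/
def Ineq120V (V C cardB₀ δ'k : ℝ) : Prop :=
  |V| ≤ C * cardB₀ * δ'k ^ 3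

/-- The chain `O(1)|𝐁₀|δ′_k³ ≦ O(1)(100MR_k)^dN²δ′_k³ ≦ g_k³O(1)M^dR_k^{d+2}A₁³p₁³(g_k)` of p. 361, PROVED from the
three inputs the text names: `|𝐁₀| ≦ (100MR_k)^dN²` (`hB₀`), *"We have assumed here that N ≦ R_k"* (`hN`, =
`B16Sect1Kernels.NWindowUpper`), `δ′_k = g_kA₁p₁(g_k)` ([IV] p. 183 l. 1, the «where» clause of (1.27) [IV] p. 182: *"δ′_j =
g_jA₁p₁(g_j), p₁(g_j) = (log g_j⁻²)^{p₁}, and p₁ < p₀"*, used silently on p. 361; `hδ'`); the final `O(1)` is `C·100^d`. [cite: Balaban1989LargeFieldII, (1.20) p.361] -/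
theorem ineq120V_arith {C cardB₀ δ'k M Rk gk A₁ p₁g : ℝ} {N d : ℕ} (hC : 0 ≤ C) (hδ : 0 ≤ δ'k)
    (hM : 0 ≤ M) (hRk : 0 ≤ Rk) (hB₀ : cardB₀ ≤ (100 * M * Rk) ^ d * (N : ℝ) ^ 2)
    (hN : B16Sect1Kernels.NWindowUpper N Rk) (hδ' : δ'k = gk * A₁ * p₁g) :
    C * cardB₀ * δ'k ^ 3 ≤ C * ((100 * M * Rk) ^ d * (N : ℝ) ^ 2) * δ'k ^ 3 ∧
      C * ((100 * M * Rk) ^ d * (N : ℝ) ^ 2) * δ'k ^ 3 ≤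
        gk ^ 3 * (C * 100 ^ d) * M ^ d * Rk ^ (d + 2) * A₁ ^ 3 * p₁g ^ 3 := by
  unfold B16Sect1Kernels.NWindowUpper at hN
  have hN0 : (0 : ℝ) ≤ N := Nat.cast_nonneg N
  have h3 : 0 ≤ δ'k ^ 3 := pow_nonneg hδ 3
  refine ⟨mul_le_mul_of_nonneg_right (mul_le_mul_of_nonneg_left hB₀ hC) h3, ?_⟩
  have h1 : (N : ℝ) ^ 2 ≤ Rk ^ 2 := pow_le_pow_left₀ hN0 hN 2
  have h2 : (100 * M * Rk) ^ d * (N : ℝ) ^ 2 ≤ (100 * M * Rk) ^ d * Rk ^ 2 :=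
    mul_le_mul_of_nonneg_left h1 (by positivity)
  calc C * ((100 * M * Rk) ^ d * (N : ℝ) ^ 2) * δ'k ^ 3 ≤ C * ((100 * M * Rk) ^ d * Rk ^ 2) * δ'k ^ 3 :=
        mul_le_mul_of_nonneg_right (mul_le_mul_of_nonneg_left h2 hC) h3
    _ = gk ^ 3 * (C * 100 ^ d) * M ^ d * Rk ^ (d + 2) * A₁ ^ 3 * p₁g ^ 3 := by
        subst hδ'
        ring

/-- **(1.20), the small terms of the quadratic form** p. 361 [7] (render p007), verbatim: *"Consider the quadratic
form in (1.20). According to the formulas (79) [15], (3.10) [13], it is equal to a sum of several terms, which are small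
except the one term determined by the operator D*ζD. … Using the estimate (1.80) [IV] and Theorem 1 [15] we see that
U⁰_{k,Z} satisfies the usual regularity conditions (2) [15], for the sequence {Ω″_j} restricted to Ω^c_k ∩ Ω″~_{h+1},
with the constant O(1)B₃²B₅M⁵ε_k instead of ε₀. From these conditions we obtain that the sum of the above mentioned
terms can be bounded by O(1)B₃⁵B₅M⁵A₁²p₁²(g_k)ε_k|𝐁₀| ≦ O(1)B₃⁵B₅M^{5+d}A₁²p₁²(g_k)R_k^{d+2}ε_k, and this bound is small
for g_k small enough."* ([15] = [Balaban1985Variational], [13] = [Balaban1985BackgroundPropagators]) — the first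
inequality as a `Prop` on the value `Q` of that sum. [cite: Balaban1989LargeFieldII, (1.20)–(1.21) p.361] -/
def Ineq120Q (Q C B₃ B₅ M A₁ p₁g εk cardB₀ : ℝ) : Prop :=
  |Q| ≤ C * B₃ ^ 5 * B₅ * M ^ 5 * A₁ ^ 2 * p₁g ^ 2 * εk * cardB₀

/-- The second inequality of that sentence, PROVED from `|𝐁₀| ≦ (100MR_k)^dN²` and `N ≦ R_k` (final `O(1)` =
`C·100^d`). [cite: Balaban1989LargeFieldII, (1.20)–(1.21) p.361] -/
theorem ineq120Q_arith {C B₃ B₅ M A₁ p₁g εk cardB₀ Rk : ℝ} {N d : ℕ} (hC : 0 ≤ C) (hB₃ : 0 ≤ B₃)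
    (hB₅ : 0 ≤ B₅) (hM : 0 ≤ M) (hεk : 0 ≤ εk) (hRk : 0 ≤ Rk)
    (hB₀ : cardB₀ ≤ (100 * M * Rk) ^ d * (N : ℝ) ^ 2) (hN : B16Sect1Kernels.NWindowUpper N Rk) :
    C * B₃ ^ 5 * B₅ * M ^ 5 * A₁ ^ 2 * p₁g ^ 2 * εk * cardB₀ ≤
      (C * 100 ^ d) * B₃ ^ 5 * B₅ * M ^ (5 + d) * A₁ ^ 2 * p₁g ^ 2 * Rk ^ (d + 2) * εk := by
  unfold B16Sect1Kernels.NWindowUpper at hN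
  have hN0 : (0 : ℝ) ≤ N := Nat.cast_nonneg N
  have h1 : cardB₀ ≤ (100 * M * Rk) ^ d * Rk ^ 2 :=
    hB₀.trans (mul_le_mul_of_nonneg_left (pow_le_pow_left₀ hN0 hN 2) (by positivity))
  have hP : 0 ≤ C * B₃ ^ 5 * B₅ * M ^ 5 * A₁ ^ 2 * p₁g ^ 2 * εk := by positivity
  calc C * B₃ ^ 5 * B₅ * M ^ 5 * A₁ ^ 2 * p₁g ^ 2 * εk * cardB₀
      ≤ C * B₃ ^ 5 * B₅ * M ^ 5 * A₁ ^ 2 * p₁g ^ 2 * εk * ((100 * M * Rk) ^ d * Rk ^ 2) :=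
        mul_le_mul_of_nonneg_left h1 hP
    _ = (C * 100 ^ d) * B₃ ^ 5 * B₅ * M ^ (5 + d) * A₁ ^ 2 * p₁g ^ 2 * Rk ^ (d + 2) * εk := by ring

/-! ## §3. p. 362: (1.23) and the field bound feeding it (row B16.Eq1.23) -/

/-- The common right-hand side of (1.23) p. 362, `B₃exp(−δMR_{h+1})·11d²(1 + β₀)²R_k^{β₀}ε_k`, reused by the
second-term bound of (1.24) and by the first-order term of (1.28) (`Rh1` = `R_{h+1}`, `Rk ^ β₀` a real power). [cite: Balaban1989LargeFieldII, (1.23) p.362] -/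
noncomputable def rhs123 (B₃ δ M Rh1 : ℝ) (d : ℕ) (β₀ Rk εk : ℝ) : ℝ :=
  B₃ * Real.exp (-(δ * M * Rh1)) * (11 * (d : ℝ) ^ 2 * (1 + β₀) ^ 2 * Rk ^ β₀ * εk)

/-- **(1.23)** p. 362 [8] (render p008), verbatim: *"By the usual reasoning the field in the argument of the function
𝐇_{𝐁₁} can be bounded by 11d²ε_h ≦ 11d²(1 + β₀)²N^{β₀}ε_k ≦ 11d²(1 + β₀)²R_k^{β₀}ε_k, hence L^jη|𝐇_{𝐁₁}|,
(L^jη)²|∇^η_{U⁰(𝐁₁)}𝐇_{𝐁₁}| < B₃exp(−δMR_{h+1})11d²(1 + β₀)²R_k^{β₀}ε_k (1.23) on Ω″_j ∩ Ω^c_k, for j = h + 1, …,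
k."* — the two displayed inequalities at a point of `Ω″_j ∩ Ω^c_k`, over the pointwise sizes `nH` = `|𝐇_{𝐁₁}|`,
`nGradH` = `|∇^η𝐇_{𝐁₁}|` and the scale factor `Ljη` = `L^jη`. [cite: Balaban1989LargeFieldII, (1.23) p.362] -/
def Ineq123 (Ljη nH nGradH B₃ δ M Rh1 : ℝ) (d : ℕ) (β₀ Rk εk : ℝ) : Prop :=
  Ljη * nH < rhs123 B₃ δ M Rh1 d β₀ Rk εk ∧ Ljη ^ 2 * nGradH < rhs123 B₃ δ M Rh1 d β₀ Rk εk

/-- The field-bound chain `11d²ε_h ≦ 11d²(1 + β₀)²N^{β₀}ε_k ≦ 11d²(1 + β₀)²R_k^{β₀}ε_k` of p. 362, PROVED from the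
[III] §2 sequence property `ε_h ≦ (1 + β₀)²N^{β₀}ε_k` (`h = k − N`; hypothesis `hεh`) and `N ≦ R_k` (p. 361;
monotonicity of the real power for `β₀ ≥ 0`). [cite: Balaban1989LargeFieldII, (1.23) p.362] -/
theorem fieldBound123_chain {εh εk β₀ Rk : ℝ} {N d : ℕ} (hεk : 0 ≤ εk) (hβ : 0 ≤ β₀)
    (hεh : εh ≤ (1 + β₀) ^ 2 * (N : ℝ) ^ β₀ * εk) (hN : B16Sect1Kernels.NWindowUpper N Rk) :
    11 * (d : ℝ) ^ 2 * εh ≤ 11 * (d : ℝ) ^ 2 * (1 + β₀) ^ 2 * (N : ℝ) ^ β₀ * εk ∧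
      11 * (d : ℝ) ^ 2 * (1 + β₀) ^ 2 * (N : ℝ) ^ β₀ * εk ≤ 11 * (d : ℝ) ^ 2 * (1 + β₀) ^ 2 * Rk ^ β₀ * εk := by
  unfold B16Sect1Kernels.NWindowUpper at hN
  have hd : (0 : ℝ) ≤ 11 * (d : ℝ) ^ 2 := by positivity
  refine ⟨?_, ?_⟩
  · calc 11 * (d : ℝ) ^ 2 * εh ≤ 11 * (d : ℝ) ^ 2 * ((1 + β₀) ^ 2 * (N : ℝ) ^ β₀ * εk) :=
          mul_le_mul_of_nonneg_left hεh hd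
      _ = _ := by ring
  · have hNβ : (N : ℝ) ^ β₀ ≤ Rk ^ β₀ := Real.rpow_le_rpow (Nat.cast_nonneg N) hN hβ
    have hc : (0 : ℝ) ≤ 11 * (d : ℝ) ^ 2 * (1 + β₀) ^ 2 := by positivity
    calc 11 * (d : ℝ) ^ 2 * (1 + β₀) ^ 2 * (N : ℝ) ^ β₀ * εk
        = 11 * (d : ℝ) ^ 2 * (1 + β₀) ^ 2 * ((N : ℝ) ^ β₀ * εk) := by ring
      _ ≤ 11 * (d : ℝ) ^ 2 * (1 + β₀) ^ 2 * (Rk ^ β₀ * εk) :=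
          mul_le_mul_of_nonneg_left (mul_le_mul_of_nonneg_right hNβ hεk) hc
      _ = _ := by ring

/-! ## §4. p. 362: the second term of (1.24) (row B16.Eq1.24) -/

/-- The multi-scale volume factor of the bound after (1.25) p. 362 [8] (render p008): *"(|Ω″_k ∩ Ω^c_k| +
L^{d−2}|Ω″_{k−1}∖Ω″_k| + ⋯ + L^{(N−1)(d−2)}|Ω″_{h+1}∖Ω″_{h+2}|)"* — with `v 0 = |Ω″_k ∩ Ω^c_k|` and `v i = |Ω″_{k−i} ∖
Ω″_{k−i+1}|` for `1 ≤ i ≤ N − 1` (volumes in the respective scales). [cite: Balaban1989LargeFieldII, (1.24)–(1.25) p.362] -/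
noncomputable def vol124 (L : ℝ) (d N : ℕ) (v : ℕ → ℝ) : ℝ :=
  ∑ i ∈ Finset.range N, L ^ (i * (d - 2)) * v i

/-- **(1.24), the second term** p. 362 [8] (render p008), verbatim: *"This equality [(1.25)], the bounds for the
configuration U₀, and the bounds (1.23) imply that the last three terms on the right-hand side of the equality (1.24)
are small, after dividing by g_k². For example, the second term can be bounded by O(1)B₃B₅M⁵ε_kB₃exp(−δMR_{h+1})11d²(1
+ β₀)²R_k^{β₀}ε_k·(|Ω″_k ∩ Ω^c_k| + L^{d−2}|Ω″_{k−1}∖Ω″_k| + ⋯ + L^{(N−1)(d−2)}|Ω″_{h+1}∖Ω″_{h+2}|) ≦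
g_k²O(1)A₀²B₃²B₅M^{d+5}R_k^{d+1}p₀²(g_k)exp(−R_k), and the number multiplying g_k² can be made arbitrarily small for g_k
small enough. Similar, or better, bounds hold for the remaining two terms."* — the printed inequality between the middle
expression (assembled from `rhs123` and the volume factor `W`, e.g. `W = vol124 L d N v`) and the final form, as a
`Prop` over its letters (the absorption `exp(−δMR_{h+1})R_k^{β₀}W ≦ O(1)M^dR_k^{d+1}exp(−R_k)` uses `N ≦ R_k` and
`δM` large — cell transcript [chk] at p. 362 — and is not re-derived here). [cite: Balaban1989LargeFieldII, (1.24)–(1.25) p.362] -/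
def Ineq124snd (C B₃ B₅ M εk δ Rh1 : ℝ) (d : ℕ) (β₀ Rk W gk C' A₀ p₀g : ℝ) : Prop :=
  C * B₃ * B₅ * M ^ 5 * εk * rhs123 B₃ δ M Rh1 d β₀ Rk εk * W ≤
    gk ^ 2 * C' * A₀ ^ 2 * B₃ ^ 2 * B₅ * M ^ (d + 5) * Rk ^ (d + 1) * p₀g ^ 2 * Real.exp (-Rk)

/-! ## §5. pp. 362–363: (1.27) and (1.28) (rows B16.Eq1.27, B16.Eq1.28) -/

/-- **(1.27)** pp. 362–363 [8–9] (render p008), verbatim: *"The remaining terms correspond to walks intersecting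
(Ω″~_{h+1})^c, hence the bound (3.108) [13] provides the additional exponential factor exp(−(1/4)δ₀MR_{h+1}). We
represent H″_{1,k,Z} as a sum of the first term and the sum of the remaining terms: H″_{1,k,Z} = H″_{1,k,X₀} +
H″_{X₀,(Ω″~_{h+1})^c}. (1.26) … The bound |DH_{X₀,(Ω″~_{h+1})^c}B| < O(1)(L^jη)^{−2}exp(−¼δ₀MR_{h+1})A₁p₁(g_k) (1.27)
allows us to estimate the second term of this decomposition in the same way as the second term of the expansion (1.24)
above, hence it is a small term."* ([13] = [Balaban1985BackgroundPropagators]) — pointwise, over `nDHB` =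
`|DH_{X₀,(Ω″~_{h+1})^c}B|` at a point of scale `j`. [cite: Balaban1989LargeFieldII, (1.27) p.362] -/
def Ineq127 (nDHB C Ljη δ₀ M Rh1 A₁ p₁g : ℝ) : Prop :=
  nDHB < C * (Ljη ^ 2)⁻¹ * Real.exp (-(1 / 4 * δ₀ * M * Rh1)) * A₁ * p₁g

/-- **(1.28), the "simple estimate"** p. 363 [9] (render p009), verbatim: *"The first term is equal to
g_k⟨DH″_{1,k,X₀}B, ζη^{−2}Im ∂U⁰_{k,Z}⟩. (1.28) … We apply the representation (1.22), and we expand (1.28) up to the first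
order in 𝐇_{𝐁₁}. A simple estimate of the expression (1.28) gives the bound g_k²O(1)A₀²B₃²B₅M^{d+5}R_k^dp₀²(g_k),"* —
on the value `T` of (1.28) (NOT small after dividing by `g_k²`; the text therefore uses criticality, (1.29)). [cite: Balaban1989LargeFieldII, (1.28) p.363] -/
def Ineq128simple (T gk C A₀ B₃ B₅ M Rk p₀g : ℝ) (d : ℕ) : Prop :=
  |T| ≤ gk ^ 2 * C * A₀ ^ 2 * B₃ ^ 2 * B₅ * M ^ (d + 5) * Rk ^ d * p₀g ^ 2

/-- **(1.28), the first-order term** p. 363 [9] (render p009), verbatim (continuing): *"hence the first order term in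
this expansion can be bounded by this number multiplied by the right-hand side of the inequality (1.23), and by some
absolute constant. Thus the first order term of this expansion is small,"* — on the value `T₁` of the first-order term
in `𝐇_{𝐁₁}`, `C'` the absolute constant. [cite: Balaban1989LargeFieldII, (1.28) p.363] -/
def Ineq128first (T₁ gk C A₀ B₃ B₅ M Rk p₀g : ℝ) (d : ℕ) (δ Rh1 β₀ εk C' : ℝ) : Prop :=
  |T₁| ≤ (gk ^ 2 * C * A₀ ^ 2 * B₃ ^ 2 * B₅ * M ^ (d + 5) * Rk ^ d * p₀g ^ 2) *
    rhs123 B₃ δ M Rh1 d β₀ Rk εk * C'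

/-! ## §6. p. 363: the two boundary-layer sums of (1.29) (row B16.Eq1.29) -/

/-- **(1.29), the layer at `∂Ω_k`** p. 363 [9] (render p009), verbatim: *"The sum on the right-hand side above is
localized in two domains on which ∂^{1*}ζ ≠ 0: the first is the boundary layer at ∂Ω_k, and the second is the boundary
layer at ∂Ω″_{h+1}. On the first domain we estimate the second sum in (1.29) by (d − 1)3ε_kη³, hence the whole
expression can be bounded by g_k(100MR_k)^{d−1}4dB₃A₀p₀(g_k)exp(−δ8MR_k)3(d − 1)ε_k, which is a small number, even
after dividing by g_k²."* — on the value `Ta` of the first-domain part of the second sum of (1.29). [cite: Balaban1989LargeFieldII, (1.29) p.363] -/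
def Ineq129a (Ta gk M Rk : ℝ) (d : ℕ) (B₃ A₀ p₀g δ εk : ℝ) : Prop :=
  |Ta| ≤ gk * (100 * M * Rk) ^ (d - 1) * (4 * d * B₃ * A₀ * p₀g) * Real.exp (-(δ * 8 * M * Rk)) *
    (3 * ((d : ℝ) - 1) * εk)

/-- **(1.29), the layer at `∂Ω″_{h+1}`** p. 363 [9] (render p009), verbatim: *"On the second domain the second sum
is estimated by (d − 1)L^{−h}O(1)B₃B₅M⁵ε_kη², and the expression is bounded by
g_k(L^hη)^{d−1}(100MR_{h+1})^{d−1}4dB₃A₀p₀(g_k)(d − 1)O(1)B₃B₅M⁵ε_k ≦ g_k²L^{−(d−1)N}N^{(d−1)β₀}O(1)A₀²B₃²B₅M^{d+5}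
R_k^{d−1}p₀²(g_k)."* — the first bound, on the value `Tb` of the second-domain part (`Lhη` = `L^hη`). [cite: Balaban1989LargeFieldII, (1.29) p.363] -/
def Ineq129b (Tb gk Lhη M Rh1 : ℝ) (d : ℕ) (B₃ A₀ p₀g C B₅ εk : ℝ) : Prop :=
  |Tb| ≤ gk * Lhη ^ (d - 1) * (100 * M * Rh1) ^ (d - 1) * (4 * d * B₃ * A₀ * p₀g) *
    (((d : ℝ) - 1) * C * B₃ * B₅ * M ^ 5 * εk)

/-- The second (displayed) inequality of that sentence, PROVED as arithmetic from the inputs the text uses: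
`L^hη = L^{−N}` (`h = k − N`, `η = L^{−k}`; `Linv` = `L^{−1}`, hypothesis `hη`), `R_{h+1} ≦ O(1)N^{β₀}R_k` (`hR`, `Nb` =
`N^{β₀}`, constant `C₃`), `ε_k = g_kA₀p₀(g_k)` (`hε`) and `M ≥ 1` (the printed `M^{d+5}` dominates the `M^{d+4}` the
product gives); the final `O(1)` is `4d(d − 1)100^{d−1}C₃^{d−1}C`. [cite: Balaban1989LargeFieldII, (1.29) p.363] -/
theorem ineq129b_arith {gk Lhη Linv M Rh1 Rk C₃ Nb B₃ A₀ p₀g C B₅ εk : ℝ} {d N : ℕ}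
    (hd : 1 ≤ d) (hgk : 0 ≤ gk) (hLinv : 0 ≤ Linv) (hM : 1 ≤ M) (hRh : 0 ≤ Rh1)
    (hC₃ : 0 ≤ C₃) (hNb : 0 ≤ Nb) (hRk : 0 ≤ Rk) (hB₅ : 0 ≤ B₅) (hC : 0 ≤ C)
    (hη : Lhη = Linv ^ N) (hR : Rh1 ≤ C₃ * Nb * Rk) (hε : εk = gk * A₀ * p₀g) :
    gk * Lhη ^ (d - 1) * (100 * M * Rh1) ^ (d - 1) * (4 * d * B₃ * A₀ * p₀g) *
        (((d : ℝ) - 1) * C * B₃ * B₅ * M ^ 5 * εk) ≤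
      gk ^ 2 * Linv ^ ((d - 1) * N) * Nb ^ (d - 1) *
        (4 * d * ((d : ℝ) - 1) * 100 ^ (d - 1) * C₃ ^ (d - 1) * C) *
        A₀ ^ 2 * B₃ ^ 2 * B₅ * M ^ (d + 5) * Rk ^ (d - 1) * p₀g ^ 2 := by
  subst hε hη
  have hd1 : (0 : ℝ) ≤ (d : ℝ) - 1 := by
    have : (1 : ℝ) ≤ d := by exact_mod_cast hd
    linarith
  have hM0 : 0 ≤ M := by linarith
  have hX0 : 0 ≤ Linv ^ N * (100 * M * Rh1) := by positivity
  have hXY : Linv ^ N * (100 * M * Rh1) ≤ Linv ^ N * (100 * M * (C₃ * Nb * Rk)) :=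
    mul_le_mul_of_nonneg_left (mul_le_mul_of_nonneg_left hR (by positivity)) (by positivity)
  have hpow : (Linv ^ N * (100 * M * Rh1)) ^ (d - 1) ≤ (Linv ^ N * (100 * M * (C₃ * Nb * Rk))) ^ (d - 1) :=
    pow_le_pow_left₀ hX0 hXY _
  have hK : 0 ≤ gk * (4 * d * ((d : ℝ) - 1) * C * B₃ ^ 2 * B₅ * M ^ 5 * (gk * A₀ ^ 2 * p₀g ^ 2)) := by
    positivity
  have hMpow : M ^ (d - 1 + 5) ≤ M ^ (d + 5) := pow_le_pow_right₀ hM (by omega)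
  calc gk * (Linv ^ N) ^ (d - 1) * (100 * M * Rh1) ^ (d - 1) * (4 * d * B₃ * A₀ * p₀g) *
        (((d : ℝ) - 1) * C * B₃ * B₅ * M ^ 5 * (gk * A₀ * p₀g))
      = (Linv ^ N * (100 * M * Rh1)) ^ (d - 1) *
          (gk * (4 * d * ((d : ℝ) - 1) * C * B₃ ^ 2 * B₅ * M ^ 5 * (gk * A₀ ^ 2 * p₀g ^ 2))) := by ring
    _ ≤ (Linv ^ N * (100 * M * (C₃ * Nb * Rk))) ^ (d - 1) *
          (gk * (4 * d * ((d : ℝ) - 1) * C * B₃ ^ 2 * B₅ * M ^ 5 * (gk * A₀ ^ 2 * p₀g ^ 2))) :=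
        mul_le_mul_of_nonneg_right hpow hK
    _ = (gk ^ 2 * Linv ^ ((d - 1) * N) * Nb ^ (d - 1) *
          (4 * d * ((d : ℝ) - 1) * 100 ^ (d - 1) * C₃ ^ (d - 1) * C) *
          A₀ ^ 2 * B₃ ^ 2 * B₅ * Rk ^ (d - 1) * p₀g ^ 2) * M ^ (d - 1 + 5) := by ring
    _ ≤ (gk ^ 2 * Linv ^ ((d - 1) * N) * Nb ^ (d - 1) *
          (4 * d * ((d : ℝ) - 1) * 100 ^ (d - 1) * C₃ ^ (d - 1) * C) *
          A₀ ^ 2 * B₃ ^ 2 * B₅ * Rk ^ (d - 1) * p₀g ^ 2) * M ^ (d + 5) :=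
        mul_le_mul_of_nonneg_left hMpow (by positivity)
    _ = _ := by ring

/-! ## §7. p. 366: the second term of (1.37) is small (SKELETON row B16.Lem@366) -/

/-- **p. 366 [12], the coupling-difference clause** (render p012), verbatim: *"The second term is in fact a small
term, because 1/(g″_k(·))² − 1/g_k² = O(N) ≦ O(R_k) on the support of ζ,"* — at one plaquette of `supp ζ`, with `c` =
the value of the coupling function `1/(g″_k(·))²` there and the `O(·)` an explicit `C`: `|c − 1/g_k²| ≤ C·N`. [cite: Balaban1989LargeFieldII, p.366 (after (1.37))] -/
def CouplingDiff366 (c gk C : ℝ) (N : ℕ) : Prop :=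
  |c - 1 / gk ^ 2| ≤ C * N

/-- `O(N) ≦ O(R_k)`: under the standing assumption `N ≦ R_k` of p. 361 (`B16Sect1Kernels.NWindowUpper`) the clause
gives `|1/(g″_k(·))² − 1/g_k²| ≤ C·R_k`. PROVED. [cite: Balaban1989LargeFieldII, p.366 (after (1.37))] -/
theorem couplingDiff366_le_Rk {c gk C Rk : ℝ} {N : ℕ} (hC : 0 ≤ C) (h : CouplingDiff366 c gk C N)
    (hN : B16Sect1Kernels.NWindowUpper N Rk) : |c - 1 / gk ^ 2| ≤ C * Rk :=
  h.trans (mul_le_mul_of_nonneg_left hN hC)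

/-- **p. 366 [12], the bound on the second term of (1.37)** (render p012), verbatim (continuing): *"so it can be
bounded by O(1)N^{2+4β₀}(100MR_k)⁴(O(1)B₃B₅M⁵ε_k + O(1)B₃δ′_k)² ≦ O(1)B₃²B₅²M⁹R_k⁷ε_k², and the bound is small for g_k
small enough. We include this term into the sum of small terms denoted by O(1) in (1.37)."* — the first inequality, on
the value `T` of the term `A((1/(g″_k(·))² − 1/g_k²)ζ, U″_{k,Z})`, with the three `O(1)`'s explicit (`C`, `C'`, `C''`;
`N^{2+4β₀}` a real power). [cite: Balaban1989LargeFieldII, p.366 (after (1.37))] -/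
def Ineq366 (T C : ℝ) (N : ℕ) (β₀ M Rk C' B₃ B₅ εk C'' δ'k : ℝ) : Prop :=
  |T| ≤ C * (N : ℝ) ^ (2 + 4 * β₀) * (100 * M * Rk) ^ 4 * (C' * B₃ * B₅ * M ^ 5 * εk + C'' * B₃ * δ'k) ^ 2

/-- The printed final form `≦ O(1)B₃²B₅²M⁹R_k⁷ε_k²` of the same sentence, typed SEPARATELY and as printed: the cell
transcript (slip D-b02.3) records that it does not follow from the middle expression (which gives `M^{14}` and keeps a
`δ′_k`-part); the text uses only that the bound tends to `0` with `g_k`. No implication between `Ineq366` and this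
`Prop` is asserted. [cite: Balaban1989LargeFieldII, p.366 (after (1.37))] -/
def Ineq366final (T C B₃ B₅ M Rk εk : ℝ) : Prop :=
  |T| ≤ C * B₃ ^ 2 * B₅ ^ 2 * M ^ 9 * Rk ^ 7 * εk ^ 2

/-! ## §8. p. 367: (1.41) and (1.45) (rows B16.Eq1.41, B16.Eq1.45) -/

/-- **(1.41)** p. 367 [13] (render p013), verbatim: *"We can prove again that Eq. (1.40) has exactly one solution
B′_Λ(B̃′), which is an analytic function of the 𝔤ᶜ-valued small field B̃′, satisfying the bound |B′_Λ(B̃′)| ≦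
4d(100M)⁵γ₀⁻¹B₃²|B̃′|. (1.41)"* — over the sizes `nB'Λ` = `|B′_Λ(B̃′)|`, `nBt` = `|B̃′|` (the norm bookkeeping
ℓ² → pointwise is the cell's GAPS G-B16-02, immaterial). [cite: Balaban1989LargeFieldII, (1.41) p.367] -/
def Ineq141 (nB'Λ nBt : ℝ) (d : ℕ) (M γ₀ B₃ : ℝ) : Prop :=
  nB'Λ ≤ 4 * d * (100 * M) ^ 5 * γ₀⁻¹ * B₃ ^ 2 * nBt

/-- (1.41) is *"a bound equal to twice a bound of the right-hand side"* (p. 359, `B16Sect1Kernels.fixedPoint_twice_bound`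
applied to (1.40)): if the solution is bounded by twice the size `nc` of the right-hand side of (1.40) and that size is
at most `2d(100M)⁵γ₀⁻¹` (the inverse bound from (1.9)) times `B₃²|B̃′|`, then (1.41). PROVED (arithmetic). [cite: Balaban1989LargeFieldII, (1.41) p.367] -/
theorem ineq141_of_twice {nB'Λ nc nBt M γ₀ B₃ : ℝ} {d : ℕ} (hx : nB'Λ ≤ 2 * nc)
    (hc : nc ≤ 2 * d * (100 * M) ^ 5 * γ₀⁻¹ * (B₃ ^ 2 * nBt)) : Ineq141 nB'Λ nBt d M γ₀ B₃ := by
  unfold Ineq141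
  linarith

/-- **(1.45)** p. 367 [13] (render p013), verbatim: *"M^j(U₀(𝐔)) = M̃^j(U′_{k,Z}(M̃^k(U′), V′_Λ(M̃^k(U′))))M^j(U₀(U))
= Ṽ_{j,Z}(M̃^k(U′))M^j(U₀(U)), (1.44) where Ṽ_{j,Z}(V′) is an analytic function of (1/i)log V′, satisfying the bound
|Ṽ_{j,Z}(V′) − 1| ≦ O(1)B₃B₅M⁵|log V′|. (1.45) The representation and the bound hold on the j^th domain of the
determining set 𝐁_k(Z), for j = 0, 1, …, k. They all hold on the domain Λ,"* — over `dev` = `|Ṽ_{j,Z}(V′) − 1|` and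
`nlogV` = `|log V′|` at a bond. [cite: Balaban1989LargeFieldII, (1.45) p.367] -/
def Ineq145 (dev C B₃ B₅ M nlogV : ℝ) : Prop :=
  dev ≤ C * B₃ * B₅ * M ^ 5 * nlogV

/-! ## §9. p. 368: the last two steps of (1.47) (row B16.Eq1.47) -/

/-- The dictionary behind the middle step of (1.47) p. 368, PROVED: with `α_{0,k} + α_{1,k} = C₁g_kq₁(g_k)` and `ε_k =
g_kA₀p₀(g_k)` ([III] (2.2)–(2.5)) one has `g_k⁻²(α_{0,k} + α_{1,k})ε_k = A₀C₁p₀(g_k)q₁(g_k)` — the passage from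
`O(1)g_k⁻²(α_{0,k} + α_{1,k})ε_k…` to `O(1)A₀C₁…p₀(g_k)q₁(g_k)…` in the display. [cite: Balaban1989LargeFieldII, (1.47) p.368] -/
theorem alphaEps_div_gsq {α εk gk C₁ q₁g A₀ p₀g : ℝ} (hgk : gk ≠ 0) (hα : α = C₁ * gk * q₁g)
    (hε : εk = gk * A₀ * p₀g) : (gk ^ 2)⁻¹ * α * εk = A₀ * C₁ * p₀g * q₁g := by
  subst hα hε
  field_simp

/-- **(1.47), the final bound** p. 368 [14] (render p014), verbatim (last two lines of the display and the sentence
after it): *"≦ O(1)A₀C₁B₃³B₅M⁶p₀(g_k)q₁(g_k)R_k²L^{−N}|Γ″_h ∩ Ω″^{~2}_{h+1}| ≦ O(1)A₀C₁B₃³B₅M^{10}p₀(g_k)q₁(g_k)R_k⁷L^{−N}.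
(1.47) The last bound above is small under the usual conditions on N. Bounds for the other terms in the expansion are
similar."* — the final form as a `Prop` on the value `T` of *"the most dangerous term, the term linear in 𝐇″_{h+2}"*,
`|⟨D𝐇″_{h+2}, (1/(g″_k(·))²)ζ₁η⁻²Im ∂U″_{h+2}⟩|` (`Linv` = `L⁻¹`; "the usual conditions on N" = the N-window of
`B16Sect1Kernels.NWindow`, cell GAPS G-B16-03). [cite: Balaban1989LargeFieldII, (1.47) p.368] -/
def Ineq147 (T C A₀ C₁ B₃ B₅ M p₀g q₁g Rk Linv : ℝ) (N : ℕ) : Prop :=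
  |T| < C * A₀ * C₁ * B₃ ^ 3 * B₅ * M ^ 10 * p₀g * q₁g * Rk ^ 7 * Linv ^ N

/-- The last step of (1.47), PROVED as arithmetic: given the count `|Γ″_h ∩ Ω″^{~2}_{h+1}| ≦ O(1)M⁴R_k⁵` (hypothesis
`hΓ`, constant `C'` — the number of points of the `h`-th set `Γ″_h` of the determining set inside `Ω″^{~2}_{h+1}`, not
derived here) the penultimate expression is at most the final one with `O(1) = C·C'`. [cite: Balaban1989LargeFieldII, (1.47) p.368] -/
theorem ineq147_lastStep {C A₀ C₁ B₃ B₅ M p₀g q₁g Rk Linv cardΓ C' : ℝ} {N : ℕ}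
    (hpre : 0 ≤ C * A₀ * C₁ * B₃ ^ 3 * B₅ * M ^ 6 * p₀g * q₁g * Rk ^ 2 * Linv ^ N)
    (hΓ : cardΓ ≤ C' * M ^ 4 * Rk ^ 5) :
    C * A₀ * C₁ * B₃ ^ 3 * B₅ * M ^ 6 * p₀g * q₁g * Rk ^ 2 * Linv ^ N * cardΓ ≤
      (C * C') * A₀ * C₁ * B₃ ^ 3 * B₅ * M ^ 10 * p₀g * q₁g * Rk ^ 7 * Linv ^ N := by
  calc C * A₀ * C₁ * B₃ ^ 3 * B₅ * M ^ 6 * p₀g * q₁g * Rk ^ 2 * Linv ^ N * cardΓ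
      ≤ C * A₀ * C₁ * B₃ ^ 3 * B₅ * M ^ 6 * p₀g * q₁g * Rk ^ 2 * Linv ^ N * (C' * M ^ 4 * Rk ^ 5) :=
        mul_le_mul_of_nonneg_left hΓ hpre
    _ = _ := by ring

/-! ## §10. p. 369: the constant `𝐂_k` (SKELETON row B16.Def@369) -/

/-- **p. 369 [15], the sum `𝐂_k` of the new boundary-type terms** (render p015), verbatim: *"In the course of the
above transformations we have created many new terms in the effective action. They have been obtained by expanding some
Wilson actions, so they have a similar structure; in particular they are easily localizable, but they depend on several
different background fields. They have, however, two important common features: they are all small, in fact their sum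
is also small, although we need boundedness only, and they depend on background fields restricted to a neighborhood of
the region Z, therefore they are boundary terms, according to our classification of terms in effective actions. We
denote the sum of all these terms, including the term I(U₀) from the denominator, by 𝐂_k."* — as the number `I(U₀) +
Σ_{i∈s} t_i` over a finite index set `s` of the created terms with values `t` (evaluated at the background fields) and
`I` = `I(U₀)` of (1.10) (`B16Sect1Wilson.I110`); the terms themselves stay abstract. [cite: Balaban1989LargeFieldII, p.369 (before (1.49))] -/
def Ck369 {ι : Type*} (s : Finset ι) (t : ι → ℝ) (I : ℝ) : ℝ :=
  I + ∑ i ∈ s, t i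

/-- *"although we need boundedness only"*: `|𝐂_k| ≤ |I(U₀)| + Σ_i |t_i|`. PROVED. [cite: Balaban1989LargeFieldII, p.369 (before (1.49))] -/
theorem abs_Ck369_le {ι : Type*} (s : Finset ι) (t : ι → ℝ) (I : ℝ) :
    |Ck369 s t I| ≤ |I| + ∑ i ∈ s, |t i| :=
  (abs_add_le _ _).trans (add_le_add le_rfl (Finset.abs_sum_le_sum_abs _ _))

/-- Boundedness of `𝐂_k` from a bound `BI` on `|I(U₀)|` (e.g. (1.11): `O(1) log M |Λ|`) and a uniform bound `τ` on the
small terms: `|𝐂_k| ≤ BI + (#terms)·τ`. PROVED. [cite: Balaban1989LargeFieldII, p.369 (before (1.49))] -/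
theorem abs_Ck369_le_of_bounds {ι : Type*} (s : Finset ι) (t : ι → ℝ) (I τ BI : ℝ) (hI : |I| ≤ BI)
    (ht : ∀ i ∈ s, |t i| ≤ τ) : |Ck369 s t I| ≤ BI + s.card * τ := by
  refine (abs_Ck369_le s t I).trans (add_le_add hI ?_)
  calc ∑ i ∈ s, |t i| ≤ ∑ i ∈ s, τ := Finset.sum_le_sum ht
    _ = s.card * τ := by rw [Finset.sum_const, nsmul_eq_mul]

/-! ## §11. p. 379: the first-order terms `σ` of `𝐓′_k(X)` are small (SKELETON row B16.Lem@379) -/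

/-- **p. 379 [25], the first-order term of the quadratic form** (render p025), verbatim: *"In order to proceed with
further operations, we have to find bounds for the operation 𝐓′_k(X). We consider the analytically extended
expressions. In the definition (1.71) only the quadratic form in B and the term V(X~) depend on (𝐔, 𝐉). We expand them
up to the first order in A′, 𝐉, the first order terms are already small. This is clear for the expansion of the
quadratic form, for which the first order term can be bounded by O(1)B₃²A₁²p₁²(g_k)|𝐁₀|(α_{0,k} + α_{1,k}) <
O(1)B₃²A₁²C₀M^dR_k^{d+2}p₁²(g_k)q₀(g_k)g_k, and this bound is small."* — the first inequality, on the value `σ₁` of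
that first-order term (`α` = `α_{0,k} + α_{1,k}`). [cite: Balaban1989LargeFieldII, p.379 (after (1.72))] -/
def SigmaQuad379 (σ₁ C B₃ A₁ p₁g cardB₀ α : ℝ) : Prop :=
  |σ₁| ≤ C * B₃ ^ 2 * A₁ ^ 2 * p₁g ^ 2 * cardB₀ * α

/-- The second inequality of that sentence, PROVED as arithmetic from `|𝐁₀| ≦ (100MR_k)^dN²`, `N ≦ R_k` and
`α_{0,k} + α_{1,k} ≦ C₀g_kq₀(g_k)` ([III] §2; hypotheses), final `O(1)` = `C·100^d`. [cite: Balaban1989LargeFieldII, p.379 (after (1.72))] -/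
theorem sigmaQuad379_arith {C B₃ A₁ p₁g cardB₀ α C₀ M Rk gk q₀g : ℝ} {d N : ℕ} (hC : 0 ≤ C) (hM : 0 ≤ M)
    (hRk : 0 ≤ Rk) (hα0 : 0 ≤ α) (hB₀ : cardB₀ ≤ (100 * M * Rk) ^ d * (N : ℝ) ^ 2)
    (hN : B16Sect1Kernels.NWindowUpper N Rk) (hα : α ≤ C₀ * gk * q₀g) :
    C * B₃ ^ 2 * A₁ ^ 2 * p₁g ^ 2 * cardB₀ * α ≤
      (C * 100 ^ d) * B₃ ^ 2 * A₁ ^ 2 * C₀ * M ^ d * Rk ^ (d + 2) * p₁g ^ 2 * q₀g * gk := by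
  unfold B16Sect1Kernels.NWindowUpper at hN
  have hN0 : (0 : ℝ) ≤ N := Nat.cast_nonneg N
  have h1 : cardB₀ ≤ (100 * M * Rk) ^ d * Rk ^ 2 :=
    hB₀.trans (mul_le_mul_of_nonneg_left (pow_le_pow_left₀ hN0 hN 2) (by positivity))
  have hP : 0 ≤ C * B₃ ^ 2 * A₁ ^ 2 * p₁g ^ 2 := by positivity
  calc C * B₃ ^ 2 * A₁ ^ 2 * p₁g ^ 2 * cardB₀ * α
      ≤ C * B₃ ^ 2 * A₁ ^ 2 * p₁g ^ 2 * ((100 * M * Rk) ^ d * Rk ^ 2) * (C₀ * gk * q₀g) :=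
        mul_le_mul (mul_le_mul_of_nonneg_left h1 hP) hα hα0 (by positivity)
    _ = _ := by ring

/-- **p. 379 [25], the first-order term of `V(X~)`** (render p025), verbatim (continuing): *"The expression V(X~) is a
sum of a big number of terms, mainly boundary terms from all the renormalization steps, depending on the configuration
(1.61)–(1.63) localized in X~. For all these terms the expansion in A′, 𝐉 creates a connection between their
localization domains and the set 𝐁₀ ∪ (Γ″_k ∩ X~), a connection with a proper exponential decay. This allows us to
resum all these terms, in the way discussed in connection with the other terms V(Y). The resummed expression has the
same bound as above, with a different constant O(1). Thus the operation 𝐓′_k(X) can be represented as the operation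
for a regular G-valued configuration U, with the additional small, and possible complex valued, term in the
exponential."* — the asserted bound on the value `σ₂` of the resummed first-order part of `V(X~)` (no derivation in
print: cell GAPS G-adv3-21); `σ = σ₁ + σ₂` is the `σ` of (1.73)–(1.75). [cite: Balaban1989LargeFieldII, p.379 (after (1.72))] -/
def SigmaV379 (σ₂ C B₃ A₁ C₀ M Rk p₁g q₀g gk : ℝ) (d : ℕ) : Prop :=
  |σ₂| ≤ C * B₃ ^ 2 * A₁ ^ 2 * C₀ * M ^ d * Rk ^ (d + 2) * p₁g ^ 2 * q₀g * gk

/-! ## §12. pp. 381–382: the small factors of the preparatory steps (SKELETON row B16.Lem@381) -/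

/-- **p. 381 [27], the factor from `1 − χ_j^{(n)}`** (render p027), verbatim: *"Besides the above large field factors
there are also the factors arising in the preparatory steps to the 𝐑-operation, and described in Sect. 1 [IV]. These
factors are connected with components of a large field region Z_j, which satisfies the conditions (i), (ii) at the
beginning of Sect. 1 [IV]. Thus, if one of the functions 1 − χ_j^{(n)} is introduced in such a component, we get a
factor exp(−¼(1/g_m²)B₃⁻²·½ε_m²) for some m satisfying j − N ≦ m ≦ j. It can be bounded by exp(−⅛B₃⁻²(1 +
β₀)⁻²A₀²p₀²(g_j)) ≦ exp(−A₁²p₀²(g_j))."* — both printed inequalities PROVED from the inputs the text uses silently: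
`ε_m = g_mA₀p₀(g_m)` ([III] (2.2)), `p₀(g_m) ≧ (1 + β₀)⁻¹p₀(g_j) ≥ 0` over the `≦ N` steps (`hp`), and the relation
`A₀² ≧ 8B₃²(1 + β₀)²A₁²` among the constants (cell ledger GAPS G-B16-07 R2, `hR2`). [cite: Balaban1989LargeFieldII, p.381 (after (1.76))] -/
theorem prep381_chi_n {gm B₃ εm A₀ p₀gm p₀gj β₀ A₁ : ℝ} (hgm : gm ≠ 0) (hB₃ : B₃ ≠ 0)
    (hε : εm = gm * A₀ * p₀gm) (hβ : 0 ≤ β₀) (hp0 : 0 ≤ p₀gj) (hp : (1 + β₀)⁻¹ * p₀gj ≤ p₀gm)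
    (hR2 : 8 * B₃ ^ 2 * (1 + β₀) ^ 2 * A₁ ^ 2 ≤ A₀ ^ 2) :
    Real.exp (-(1 / 4 * (1 / gm ^ 2) * (B₃ ^ 2)⁻¹ * (1 / 2) * εm ^ 2)) ≤
        Real.exp (-(1 / 8 * (B₃ ^ 2)⁻¹ * ((1 + β₀) ^ 2)⁻¹ * A₀ ^ 2 * p₀gj ^ 2)) ∧
      Real.exp (-(1 / 8 * (B₃ ^ 2)⁻¹ * ((1 + β₀) ^ 2)⁻¹ * A₀ ^ 2 * p₀gj ^ 2)) ≤
        Real.exp (-(A₁ ^ 2 * p₀gj ^ 2)) := by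
  have hb : 0 < 1 + β₀ := by linarith
  have hB2 : 0 < B₃ ^ 2 := by positivity
  have hu : 0 < (B₃ ^ 2)⁻¹ := inv_pos.mpr hB2
  have hv : 0 < ((1 + β₀) ^ 2)⁻¹ := inv_pos.mpr (by positivity)
  refine ⟨Real.exp_le_exp.mpr ?_, Real.exp_le_exp.mpr ?_⟩
  · -- `ε_m²/g_m² = A₀²p₀(g_m)²` and `p₀(g_m)² ≥ (1+β₀)⁻²p₀(g_j)²`
    subst hε
    have e1 : 1 / 4 * (1 / gm ^ 2) * (B₃ ^ 2)⁻¹ * (1 / 2) * (gm * A₀ * p₀gm) ^ 2 =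
        1 / 8 * (B₃ ^ 2)⁻¹ * A₀ ^ 2 * p₀gm ^ 2 := by
      field_simp
      ring
    have hq0 : 0 ≤ (1 + β₀)⁻¹ * p₀gj := mul_nonneg (inv_nonneg.mpr hb.le) hp0
    have hsq : ((1 + β₀)⁻¹ * p₀gj) ^ 2 ≤ p₀gm ^ 2 := pow_le_pow_left₀ hq0 hp 2
    have e2 : ((1 + β₀)⁻¹ * p₀gj) ^ 2 = ((1 + β₀) ^ 2)⁻¹ * p₀gj ^ 2 := by rw [mul_pow, inv_pow]
    rw [e2] at hsq
    have hc : 0 ≤ 1 / 8 * (B₃ ^ 2)⁻¹ * A₀ ^ 2 := by positivity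
    have := mul_le_mul_of_nonneg_left hsq hc
    rw [e1]
    nlinarith [this]
  · -- `⅛B₃⁻²(1+β₀)⁻²A₀² ≥ A₁²` from R2
    have key : A₁ ^ 2 ≤ 1 / 8 * (B₃ ^ 2)⁻¹ * ((1 + β₀) ^ 2)⁻¹ * A₀ ^ 2 := by
      rw [show 1 / 8 * (B₃ ^ 2)⁻¹ * ((1 + β₀) ^ 2)⁻¹ * A₀ ^ 2 = A₀ ^ 2 / (8 * B₃ ^ 2 * (1 + β₀) ^ 2) by
        field_simp]
      rw [le_div_iff₀ (by positivity)]
      linarith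
    nlinarith [mul_le_mul_of_nonneg_right key (sq_nonneg p₀gj)]

/-- **p. 381 [27], the factor from `1 − χ′_m`** (render p027), verbatim: *"The function 1 − χ′_m, where χ′_m is given
by (1.27) [IV], yields the factor exp(−γ₀(1/g_m²)(2δ′_m)²) ≦ exp(−γ₀4(1 + β₀)⁻²A₁²p₁²(g_j)) ≦ exp(−γ₀A₁²p₁²(g_j)). The
second function in the decomposition (1.28) [IV] yields the same final factor."* — both inequalities PROVED from `δ′_m =
g_mA₁p₁(g_m)` ([IV] p. 183 l. 1, the «where» clause of (1.27) [IV] p. 182), `p₁(g_m) ≧ (1 + β₀)⁻¹p₁(g_j) ≥ 0`, `γ₀ ≥ 0`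
and `0 ≦ β₀ ≦ 1` (so that `4(1 + β₀)⁻² ≧ 1`). [cite: Balaban1989LargeFieldII, p.381 (after (1.76))] -/
theorem prep381_chi' {γ₀ gm δ'm A₁ p₁gm p₁gj β₀ : ℝ} (hgm : gm ≠ 0) (hγ : 0 ≤ γ₀)
    (hδ : δ'm = gm * A₁ * p₁gm) (hβ0 : 0 ≤ β₀) (hβ1 : β₀ ≤ 1) (hp0 : 0 ≤ p₁gj)
    (hp : (1 + β₀)⁻¹ * p₁gj ≤ p₁gm) :
    Real.exp (-(γ₀ * (1 / gm ^ 2) * (2 * δ'm) ^ 2)) ≤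
        Real.exp (-(γ₀ * 4 * ((1 + β₀) ^ 2)⁻¹ * A₁ ^ 2 * p₁gj ^ 2)) ∧
      Real.exp (-(γ₀ * 4 * ((1 + β₀) ^ 2)⁻¹ * A₁ ^ 2 * p₁gj ^ 2)) ≤
        Real.exp (-(γ₀ * A₁ ^ 2 * p₁gj ^ 2)) := by
  have hb : 0 < 1 + β₀ := by linarith
  have hv : 0 < ((1 + β₀) ^ 2)⁻¹ := inv_pos.mpr (by positivity)
  refine ⟨Real.exp_le_exp.mpr ?_, Real.exp_le_exp.mpr ?_⟩
  · subst hδ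
    have e1 : γ₀ * (1 / gm ^ 2) * (2 * (gm * A₁ * p₁gm)) ^ 2 = γ₀ * 4 * A₁ ^ 2 * p₁gm ^ 2 := by
      field_simp
      ring
    have hq0 : 0 ≤ (1 + β₀)⁻¹ * p₁gj := mul_nonneg (inv_nonneg.mpr hb.le) hp0
    have hsq : ((1 + β₀)⁻¹ * p₁gj) ^ 2 ≤ p₁gm ^ 2 := pow_le_pow_left₀ hq0 hp 2
    have e2 : ((1 + β₀)⁻¹ * p₁gj) ^ 2 = ((1 + β₀) ^ 2)⁻¹ * p₁gj ^ 2 := by rw [mul_pow, inv_pow]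
    rw [e2] at hsq
    have hc : 0 ≤ γ₀ * 4 * A₁ ^ 2 := by positivity
    have := mul_le_mul_of_nonneg_left hsq hc
    rw [e1]
    nlinarith [this]
  · have key : (1 : ℝ) ≤ 4 * ((1 + β₀) ^ 2)⁻¹ := by
      rw [show 4 * ((1 + β₀) ^ 2)⁻¹ = 4 / (1 + β₀) ^ 2 by ring, le_div_iff₀ (by positivity)]
      nlinarith
    have hc : 0 ≤ γ₀ * A₁ ^ 2 * p₁gj ^ 2 := by positivity
    nlinarith [mul_le_mul_of_nonneg_left key hc]

/-- **p. 381 [27], the factor from `1 − χ_{j,Λ}`** (render p027), verbatim: *"The function 1 − χ_{j,Λ} yields the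
factor exp(−¼(1/g_j²)(O(1)B₃M²)⁻¹ε_j²) ≦ exp(−A₁²p₀²(g_j)), as it was proved in Sect. 1 [IV] after the definition
(1.75) [IV]."* — PROVED from `ε_j = g_jA₀p₀(g_j)` and the relation `A₀² ≧ 4(O(1)B₃M²)A₁²` among the constants (cell
ledger GAPS G-B16-07 R3: an `M`-dependent lower bound on `A₀/A₁`, admissible because `A₀` is fixed after `M`; `K` =
the printed `O(1)B₃M²`). [cite: Balaban1989LargeFieldII, p.381 (after (1.76))] -/
theorem prep381_chiΛ {gj K εj A₀ p₀gj A₁ : ℝ} (hgj : gj ≠ 0) (hK : 0 < K) (hε : εj = gj * A₀ * p₀gj)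
    (hR3 : 4 * K * A₁ ^ 2 ≤ A₀ ^ 2) :
    Real.exp (-(1 / 4 * (1 / gj ^ 2) * K⁻¹ * εj ^ 2)) ≤ Real.exp (-(A₁ ^ 2 * p₀gj ^ 2)) := by
  refine Real.exp_le_exp.mpr ?_
  subst hε
  have e1 : 1 / 4 * (1 / gj ^ 2) * K⁻¹ * (gj * A₀ * p₀gj) ^ 2 = (A₀ ^ 2 / (4 * K)) * p₀gj ^ 2 := by
    field_simp
  have key : A₁ ^ 2 ≤ A₀ ^ 2 / (4 * K) := by
    rw [le_div_iff₀ (by positivity)]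
    linarith
  rw [e1]
  nlinarith [mul_le_mul_of_nonneg_right key (sq_nonneg p₀gj)]

/-- **p. 382 [28], case 1 of `1 − χ′`: the axial-gauge estimate** (render p028), verbatim: *"By elementary reasoning,
the same as in the proof of Lemma 1 [14], we obtain the estimate |V₁(b) − 1| < 6(100MR_{j−N+1})²ε ≦ 6(100M(L +
1)N^{β₀}R_j)²ε, where we have taken into account that Ω″^c_{h+1} satisfies the condition (i)."* ([14] =
[Balaban1985RegularSpaces], Lemma 1) — the first inequality on `dev` = `|V₁(b) − 1|` with `R'` = `R_{j−N+1}`. [cite: Balaban1989LargeFieldII, p.382 (before (1.77))] -/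
def Ineq382V₁ (dev M R' ε : ℝ) : Prop :=
  dev < 6 * (100 * M * R') ^ 2 * ε

/-- The second inequality of that display, PROVED from `R_{j−N+1} ≦ (L + 1)N^{β₀}R_j` (the [III] §2 growth of `R` over
`N` steps; hypothesis `hR'`, `Nb` = `N^{β₀}`). [cite: Balaban1989LargeFieldII, p.382 (before (1.77))] -/
theorem ineq382V₁_mono {dev M R' ε L Nb Rj : ℝ} (hM : 0 ≤ M) (hR0 : 0 ≤ R') (hε : 0 ≤ ε)
    (hR' : R' ≤ (L + 1) * Nb * Rj) (h : Ineq382V₁ dev M R' ε) :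
    dev < 6 * (100 * M * ((L + 1) * Nb * Rj)) ^ 2 * ε := by
  unfold Ineq382V₁ at h
  have h1 : (100 * M * R') ^ 2 ≤ (100 * M * ((L + 1) * Nb * Rj)) ^ 2 :=
    pow_le_pow_left₀ (by positivity) (mul_le_mul_of_nonneg_left hR' (by positivity)) 2
  have h2 : 6 * (100 * M * R') ^ 2 * ε ≤ 6 * (100 * M * ((L + 1) * Nb * Rj)) ^ 2 * ε :=
    mul_le_mul_of_nonneg_right (mul_le_mul_of_nonneg_left h1 (by norm_num)) hε
  exact lt_of_lt_of_le h h2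

/-- **p. 382 [28], case 1: the estimate of `V′(b)`** (render p028), verbatim: *"From the above estimates we obtain
|V′(b) − 1| < 6(100M(L + 1)R_j^{1+β₀})²ε + O(1)(A₀/A₁)B₃²B₅M⁷R_j^{1+β₀}(p₀(g_j)/p₁(g_j))L^{−N}δ′_j. By our assumptions on
N the number multiplying δ′_j is small, e.g., it is smaller than 1/4,"* — the displayed inequality on `dev` = `|V′(b) −
1|` (`R_j^{1+β₀}` a real power, `Linv` = `L⁻¹`). [cite: Balaban1989LargeFieldII, p.382 (before (1.77))] -/
def Ineq382V' (dev M L Rj β₀ ε C A₀ A₁ B₃ B₅ p₀g p₁g Linv : ℝ) (N : ℕ) (δ'j : ℝ) : Prop :=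
  dev < 6 * (100 * M * (L + 1) * Rj ^ (1 + β₀)) ^ 2 * ε +
    C * (A₀ / A₁) * B₃ ^ 2 * B₅ * M ^ 7 * Rj ^ (1 + β₀) * (p₀g / p₁g) * Linv ^ N * δ'j

/-- **p. 382 [28], case 1: the choice of `ε`** (render p028), verbatim: *"hence we have |B′(b)| < 12R_j⁴ε + ½δ′_j. If we
take ε = (24R_j⁴)⁻¹δ′_j, then |B′(b)| < δ′_j. This implies that at least one plaquette variable has to satisfy the
opposite inequality, i.e., |V″(∂p′) − 1| ≧ (24R_j⁴)⁻¹δ′_j for some p′ ⊂ Ω″^{~2}_{h+1}∖Ω″_{h+1}."* — the arithmetic of the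
choice, PROVED (`12R_j⁴·(24R_j⁴)⁻¹δ′_j = ½δ′_j`). [cite: Balaban1989LargeFieldII, p.382 (before (1.77))] -/
theorem prep382_eps_choice {nB' Rj ε δ'j : ℝ} (hRj : Rj ≠ 0) (h : nB' < 12 * Rj ^ 4 * ε + 1 / 2 * δ'j)
    (hε : ε = (24 * Rj ^ 4)⁻¹ * δ'j) : nB' < δ'j := by
  subst hε
  have hR4 : Rj ^ 4 ≠ 0 := pow_ne_zero 4 hRj
  have e : 12 * Rj ^ 4 * ((24 * Rj ^ 4)⁻¹ * δ'j) = 1 / 2 * δ'j := by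
    field_simp
    ring
  linarith [e]

/-- **p. 382 [28], case 1: the resulting Wilson factor** (render p028), verbatim: *"Then the Wilson action yields the
factor exp(−¼(1/g_j²)(24R_j⁴)⁻²δ′_j²) = exp(−A₁²48⁻²R_j⁻⁸p₁²(g_j)) ≦ exp(−R_j⁻⁸p₁²(g_j))."* — the equality PROVED from
`δ′_j = g_jA₁p₁(g_j)` (`¼·24⁻² = 48⁻²`), the inequality from the relation `A₁ ≧ 48` among the constants (cell ledger
GAPS G-B16-07 R4). [cite: Balaban1989LargeFieldII, p.382 (before (1.77))] -/
theorem prep382_case1_factor {gj Rj δ'j A₁ p₁gj : ℝ} (hgj : gj ≠ 0) (hRj : Rj ≠ 0)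
    (hδ : δ'j = gj * A₁ * p₁gj) (hR4 : 48 ≤ A₁) :
    Real.exp (-(1 / 4 * (1 / gj ^ 2) * ((24 * Rj ^ 4) ^ 2)⁻¹ * δ'j ^ 2)) =
        Real.exp (-(A₁ ^ 2 * (48 ^ 2 : ℝ)⁻¹ * (Rj ^ 8)⁻¹ * p₁gj ^ 2)) ∧
      Real.exp (-(A₁ ^ 2 * (48 ^ 2 : ℝ)⁻¹ * (Rj ^ 8)⁻¹ * p₁gj ^ 2)) ≤
        Real.exp (-((Rj ^ 8)⁻¹ * p₁gj ^ 2)) := by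
  have hR8 : 0 < (Rj ^ 8)⁻¹ := inv_pos.mpr (by positivity)
  refine ⟨?_, Real.exp_le_exp.mpr ?_⟩
  · congr 2
    subst hδ
    have hR4' : Rj ^ 4 ≠ 0 := pow_ne_zero 4 hRj
    field_simp
    ring
  · have key : (1 : ℝ) ≤ A₁ ^ 2 * (48 ^ 2 : ℝ)⁻¹ := by
      rw [show A₁ ^ 2 * (48 ^ 2 : ℝ)⁻¹ = A₁ ^ 2 / 48 ^ 2 by ring, le_div_iff₀ (by positivity)]
      nlinarith
    have hc : 0 ≤ (Rj ^ 8)⁻¹ * p₁gj ^ 2 := by positivity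
    nlinarith [mul_le_mul_of_nonneg_right key hc]


/-! ## §13 (v2, append-only). p. 357: the third-order term of (1.2) (row B16.Txt@357) -/

/-- **p. 357 [3], the `V`-term of (1.2)** (render p003 re-read by this seat), verbatim: *"The last term in the
exponential is small, because the function V is at least of third order in the argument. It can be estimated by
O(g_k^{1−β})|Λ|."* — on the value `T` of the last term `g_k⁻²V(ζ₀, g_kH_{1,k}B′)` of the exponential of (1.2), with the
`O(·)` an explicit `C`, a real power `g_k^{1−β}` and `volΛ` = `|Λ|`. [cite: Balaban1989LargeFieldII, (1.2) p.357] -/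
def Ineq12V (T C gk β volΛ : ℝ) : Prop :=
  |T| ≤ C * gk ^ (1 - β) * volΛ

/-! ## §14 (v2, append-only). p. 376: the inductive decay factor and the exponential (1.66)
(rows B16.Txt@376, B16.Eq1.66) -/

/-- **p. 376 [22], the inductive factor** (render p022 re-read by this seat), verbatim: *"The inductive assumption
yields the factor exp(−κd_j(X)) ≦ exp(−βκd_j(X))exp(−(1 − β)κ(L^jη)⁻¹d_k(Y₀)) ≦ exp(−βκd_j(X))exp(−(1 + 3β)κd_k(Y₀))
for j < k, where Y₀ is the smallest domain from 𝐃_k containing X, and exp(−(1 + 4β)κd_k(X)) for j = k, from the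
improved bounds after the k^th renormalization transformation T."* — both displayed inequalities PROVED from the
inputs the text uses: `d_j(X) ≧ (L^jη)⁻¹d_k(Y₀)` (the tree length of `X` in `L^{−j}`-units dominates that of `Y₀ ⊇ X`
in `L^{−k}`-units; hypothesis `hd`, with `s` = `(L^jη)⁻¹`), `κ ≥ 0`, `β ≤ 1`, and for the second one `(L^jη)⁻¹ ≧ L`
(`j < k`, `η = L^{−k}`; `hscale`) together with `(1 − β)L ≧ 1 + 3β` (`hL`; e.g. `L ≥ 7/3` at `β ≤ 1/4` — cell
transcript [chk] at p. 376). [cite: Balaban1989LargeFieldII, p.376 (before (1.66))] -/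
theorem ineq376_split {κ β djX dkY s L : ℝ} (hκ : 0 ≤ κ) (hβ : β ≤ 1) (hdk : 0 ≤ dkY)
    (hd : s * dkY ≤ djX) (hscale : L ≤ s) (hL : 1 + 3 * β ≤ (1 - β) * L) :
    Real.exp (-(κ * djX)) ≤ Real.exp (-(β * κ * djX)) * Real.exp (-((1 - β) * κ * s * dkY)) ∧
      Real.exp (-(β * κ * djX)) * Real.exp (-((1 - β) * κ * s * dkY)) ≤
        Real.exp (-(β * κ * djX)) * Real.exp (-((1 + 3 * β) * κ * dkY)) := by
  refine ⟨?_, ?_⟩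
  · rw [← Real.exp_add]
    refine Real.exp_le_exp.mpr ?_
    have h1 : 0 ≤ (1 - β) * κ := mul_nonneg (by linarith) hκ
    have h2 := mul_le_mul_of_nonneg_left hd h1
    linarith
  · refine mul_le_mul_of_nonneg_left (Real.exp_le_exp.mpr ?_) (Real.exp_pos _).le
    have h1b : 0 ≤ 1 - β := by linarith
    have h2 : 1 + 3 * β ≤ (1 - β) * s := hL.trans (mul_le_mul_of_nonneg_left hscale h1b)
    have h3 : 0 ≤ κ * dkY := mul_nonneg hκ hdk
    have h4 := mul_le_mul_of_nonneg_right h2 h3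
    linarith

/-- **(1.66)** p. 376 [22] (render p022), verbatim: *"Thus we obtain the follwing [sic] exponential factor for the term
in the expansion, corresponding to domains Y′₂, Y′₃, Y′₄ with a nonempty union: exp(−βκd_j(X) − (1 + 3β)d_k(Y₀) −
δd((Y₁⁰)^c ∩ Y₁ ∩ Y′_{i₀}, X) − Σ_{i=2}^{4}(κ₁ − 1)M^{−d}|Y′_i|), (1.66) where i₀ is the index of the first nonempty
domain Y′_i."* — the factor as a real number over its letters: `djX` = `d_j(X)`, `dkY₀` = `d_k(Y₀)`, `dist` =
`d((Y₁⁰)^c ∩ Y₁ ∩ Y′_{i₀}, X)`, `vol i` = `|Y′_i|` (`i = 2, 3, 4`), `Minvd` = `M^{−d}`.  The second term is PRINTED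
without `κ`; it is typed WITH `κ`, as on the line above it (`exp(−(1 + 3β)κd_k(Y₀))`) and in the following paragraph
(*"we can extract the factor exp(−(1 + 3β)κd_{k,Z}(Y₄)) from the exponential (1.66)"*) — a print slip recorded in the
cell transcript (D-b02.4). [cite: Balaban1989LargeFieldII, (1.66) p.376] -/
noncomputable def factor166 (β κ djX dkY₀ δ dist κ₁ Minvd : ℝ) (vol : ℕ → ℝ) : ℝ :=
  Real.exp (-(β * κ * djX) - (1 + 3 * β) * κ * dkY₀ - δ * dist -
    ∑ i ∈ Finset.Icc 2 4, (κ₁ - 1) * Minvd * vol i)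

/-- p. 376 [22] (render p022), the exponential that remains after the extraction, verbatim: *"The above considerations
imply that we can extract the factor exp(−(1 + 3β)κd_{k,Z}(Y₄)) from the exponential (1.66), and the following
exponential remains: exp(−βκd_j(X) − ½δd((Y₁⁰)^c ∩ Y₁ ∩ Y′_{i₀}, X) − Σ_{i=2}^{4}½(κ₁ − 1)M^{−d}|Y′_i|)."* (`d_{k,Z}` =
the relative linear size (1.67)). [cite: Balaban1989LargeFieldII, (1.66)–(1.67) p.376] -/
noncomputable def remaining166 (β κ djX δ dist κ₁ Minvd : ℝ) (vol : ℕ → ℝ) : ℝ :=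
  Real.exp (-(β * κ * djX) - 1 / 2 * δ * dist - ∑ i ∈ Finset.Icc 2 4, 1 / 2 * (κ₁ - 1) * Minvd * vol i)

/-- The extraction step of p. 376, PROVED as arithmetic under the geometric input it needs (cell transcript [chk] at
(1.66)–(1.67), GAPS G-B16-05: the relative tree length `d_{k,Z}(Y₄)` of (1.67) must be paid by `d_k(Y₀)`, half the
distance term and half the volume terms — hypothesis `hext`): then `factor166 ≤ exp(−(1 + 3β)κd_{k,Z}(Y₄)) ·
remaining166`. [cite: Balaban1989LargeFieldII, (1.66)–(1.67) p.376] -/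
theorem factor166_le_extract {β κ djX dkY₀ δ dist κ₁ Minvd dkZ : ℝ} {vol : ℕ → ℝ}
    (hext : (1 + 3 * β) * κ * dkZ ≤ (1 + 3 * β) * κ * dkY₀ + 1 / 2 * δ * dist +
      ∑ i ∈ Finset.Icc 2 4, 1 / 2 * (κ₁ - 1) * Minvd * vol i) :
    factor166 β κ djX dkY₀ δ dist κ₁ Minvd vol ≤
      Real.exp (-((1 + 3 * β) * κ * dkZ)) * remaining166 β κ djX δ dist κ₁ Minvd vol := by
  unfold factor166 remaining166
  rw [← Real.exp_add]
  refine Real.exp_le_exp.mpr ?_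
  have hsum : ∑ i ∈ Finset.Icc 2 4, (κ₁ - 1) * Minvd * vol i =
      2 * ∑ i ∈ Finset.Icc 2 4, 1 / 2 * (κ₁ - 1) * Minvd * vol i := by
    rw [Finset.mul_sum]
    exact Finset.sum_congr rfl fun i _ => by ring
  rw [hsum]
  linarith

/-! ## §15 (v3, append-only). p. 379: the quadratic-form half `σ_Q` of `σ` DERIVED over a finite-kernel model
(row B16.Lem@379)

p. 379 [25] ll. 27–30 (render p025): *"This is clear for the expansion of the quadratic form, for which the first order
term can be bounded by O(1)B₃²A₁²p₁²(g_k)|𝐁₀|(α_{0,k} + α_{1,k})"* — §11 typed this first inequality as the `Prop`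
`SigmaQuad379` and PROVED the second inequality (`sigmaQuad379_arith`) and the smallness clause
(`B16Sect1SmallFactors.sigmaQuad379_small`).  Here the first inequality itself is DERIVED, over the schematic carrier the
block uses for (1.71)–(1.75) (cell DIVERGENCE «schematic typing»; `B16.ineq173`–`ineq175` model `𝐓′_k(X)` as a finite
positive functional), from the letters the cell's adjudication C-adv7-18 (d) located in print:
* the B-variables of the integral (1.71) p. 378 are indexed by the finite set `S = (𝐁₀∖T₀) ∩ X ⊂ 𝐁₀` (the
  normalization factor `(−½d(𝔤)log g_k⁻² + log σ₀)|(𝐁₀∖T₀) ∩ X|` of (1.71) counts them), so `|S| ≦ |𝐁₀|` (`hS`);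
* on the support of `χ′` they are small: [IV] (1.82) p. 196 *"χ′ = χ({|B′(b)| < δ′_k for b ∈ 𝐁₀})"* with `B′ = g_kB`
  (the density carries `σ(g_kB)`, (1.71)) and `δ′_k = g_kA₁p₁(g_k)` ((1.6) p. 357), i.e. `‖B(b)‖ ≦ A₁p₁(g_k)` (`hB`);
* the quadratic form of (1.71) is `−½⟨DH″_{1,k,X}B, ζDH″_{1,k,X}B⟩ = Σ_{x,y∈S} B(x)K_{(𝐔,𝐉)}(x,y)B(y)` with a kernel
  depending on the argument pair `(𝐔,𝐉)` through the propagator `H″_{1,k,X}`; *"first order in A′, 𝐉"* = the kernel's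
  variation between `(𝐔,𝐉)` and the base point `(U,0)` has row sums `≦ O(1)B₃²(α_{0,k} + α_{1,k})` (`hK`: two
  `H`-factors bounded by `B₃` each — [IV] (1.94) p. 198 *"The function H″Π above, and its derivatives, can be bounded
  … by B₃δ′_k + …"* — times the size `α_{0,k} + α_{1,k}` of `(A′,𝐉)` in the analyticity domain (1.65));
* `σ_Q` is the EXACT difference of the form at `(𝐔,𝐉)` and at `(U,0)` (C-adv7-18 (c): *"σ is exact, «first order» is
  its bound"*), possibly complex (p. 379 l. 36 *"possible complex valued"*), entering `SigmaQuad379` by its norm (this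
  module's convention: the bounded quantity enters as a real letter = its value or norm).
Then `‖σ_Q‖ ≦ Σ_{x,y}‖B(x)‖‖δK(x,y)‖‖B(y)‖ ≦ (A₁p₁(g_k))²·Σ_x Σ_y‖δK(x,y)‖ ≦ O(1)B₃²(α_{0,k}+α_{1,k})·|S|·A₁²p₁²(g_k)`,
which is the printed bound (`sigmaQuad379_of_kernel`); the ℓ² road (Schur's test: row AND column sums, then
`‖B‖₂² ≦ |S|·sup‖B‖²`) gives the same (`sigmaQuad379_of_kernel_schur`), and composing with §11's arithmetic gives the
printed second bound (`sigmaQuad379_chain_of_kernel`).  Nothing is added to what print asserts: the `V(X~)` half `σ_V`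
(`SigmaV379`, cell GAPS G-adv3-21) is untouched, and the kernel letters `K₀`, `K₁` stay abstract like every object of
this module. -/

/-- Finite-kernel bookkeeping, sup road: if `‖v(x)‖ ≦ Φ` on `S` and the kernel's row sums over `S` are `≦ κ`, then
`‖Σ_{x∈S}Σ_{y∈S} v(x)K(x,y)v(y)‖ ≦ κ·|S|·Φ²`. [folklore] -/
private theorem norm_sum_sum_mul_le_of_rowSum {ι 𝕜 : Type*} [NormedField 𝕜] (S : Finset ι) (v : ι → 𝕜)
    (K : ι → ι → 𝕜) {Φ κ : ℝ} (hv : ∀ x ∈ S, ‖v x‖ ≤ Φ) (hK : ∀ x ∈ S, ∑ y ∈ S, ‖K x y‖ ≤ κ) :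
    ‖∑ x ∈ S, ∑ y ∈ S, v x * K x y * v y‖ ≤ κ * S.card * Φ ^ 2 := by
  have hterm : ∀ x ∈ S, ∀ y ∈ S, ‖v x * K x y * v y‖ ≤ Φ * ‖K x y‖ * Φ := by
    intro x hx y hy
    have hΦ : 0 ≤ Φ := (norm_nonneg _).trans (hv x hx)
    rw [norm_mul, norm_mul]
    exact mul_le_mul (mul_le_mul_of_nonneg_right (hv x hx) (norm_nonneg _)) (hv y hy) (norm_nonneg _)
      (mul_nonneg hΦ (norm_nonneg _))
  calc ‖∑ x ∈ S, ∑ y ∈ S, v x * K x y * v y‖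
      ≤ ∑ x ∈ S, ‖∑ y ∈ S, v x * K x y * v y‖ := norm_sum_le _ _
    _ ≤ ∑ x ∈ S, ∑ y ∈ S, ‖v x * K x y * v y‖ := Finset.sum_le_sum fun x _ => norm_sum_le _ _
    _ ≤ ∑ x ∈ S, ∑ y ∈ S, Φ * ‖K x y‖ * Φ :=
        Finset.sum_le_sum fun x hx => Finset.sum_le_sum fun y hy => hterm x hx y hy
    _ = Φ ^ 2 * ∑ x ∈ S, ∑ y ∈ S, ‖K x y‖ := by
        rw [Finset.mul_sum]
        refine Finset.sum_congr rfl fun x _ => ?_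
        rw [Finset.mul_sum]
        exact Finset.sum_congr rfl fun y _ => by ring
    _ ≤ Φ ^ 2 * ∑ x ∈ S, κ := by
        exact mul_le_mul_of_nonneg_left (Finset.sum_le_sum hK) (sq_nonneg _)
    _ = κ * S.card * Φ ^ 2 := by rw [Finset.sum_const, nsmul_eq_mul]; ring

/-- Finite-kernel bookkeeping, ℓ² road (Schur's test): if the kernel's row sums AND column sums over `S` are `≦ κ`,
then `‖Σ_{x∈S}Σ_{y∈S} v(x)K(x,y)v(y)‖ ≦ κ·Σ_{x∈S}‖v(x)‖²` — by `‖v(x)‖‖v(y)‖ ≦ ½(‖v(x)‖² + ‖v(y)‖²)`. [folklore] -/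
private theorem norm_sum_sum_mul_le_of_schur {ι 𝕜 : Type*} [NormedField 𝕜] (S : Finset ι) (v : ι → 𝕜)
    (K : ι → ι → 𝕜) {κ : ℝ} (hrow : ∀ x ∈ S, ∑ y ∈ S, ‖K x y‖ ≤ κ) (hcol : ∀ y ∈ S, ∑ x ∈ S, ‖K x y‖ ≤ κ) :
    ‖∑ x ∈ S, ∑ y ∈ S, v x * K x y * v y‖ ≤ κ * ∑ x ∈ S, ‖v x‖ ^ 2 := by
  have hterm : ∀ x y, ‖v x * K x y * v y‖ ≤
      1 / 2 * (‖K x y‖ * ‖v x‖ ^ 2) + 1 / 2 * (‖K x y‖ * ‖v y‖ ^ 2) := by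
    intro x y
    rw [norm_mul, norm_mul]
    nlinarith [sq_nonneg (‖v x‖ - ‖v y‖), norm_nonneg (K x y), norm_nonneg (v x), norm_nonneg (v y),
      mul_nonneg (norm_nonneg (K x y)) (sq_nonneg (‖v x‖ - ‖v y‖))]
  have h1 : ∑ x ∈ S, ∑ y ∈ S, ‖K x y‖ * ‖v x‖ ^ 2 ≤ κ * ∑ x ∈ S, ‖v x‖ ^ 2 := by
    rw [Finset.mul_sum]
    refine Finset.sum_le_sum fun x hx => ?_
    rw [← Finset.sum_mul]
    exact mul_le_mul_of_nonneg_right (hrow x hx) (sq_nonneg _)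
  have h2 : ∑ x ∈ S, ∑ y ∈ S, ‖K x y‖ * ‖v y‖ ^ 2 ≤ κ * ∑ y ∈ S, ‖v y‖ ^ 2 := by
    rw [Finset.sum_comm, Finset.mul_sum]
    refine Finset.sum_le_sum fun y hy => ?_
    rw [← Finset.sum_mul]
    exact mul_le_mul_of_nonneg_right (hcol y hy) (sq_nonneg _)
  calc ‖∑ x ∈ S, ∑ y ∈ S, v x * K x y * v y‖
      ≤ ∑ x ∈ S, ‖∑ y ∈ S, v x * K x y * v y‖ := norm_sum_le _ _
    _ ≤ ∑ x ∈ S, ∑ y ∈ S, ‖v x * K x y * v y‖ := Finset.sum_le_sum fun x _ => norm_sum_le _ _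
    _ ≤ ∑ x ∈ S, ∑ y ∈ S, (1 / 2 * (‖K x y‖ * ‖v x‖ ^ 2) + 1 / 2 * (‖K x y‖ * ‖v y‖ ^ 2)) :=
        Finset.sum_le_sum fun x _ => Finset.sum_le_sum fun y _ => hterm x y
    _ = 1 / 2 * ∑ x ∈ S, ∑ y ∈ S, ‖K x y‖ * ‖v x‖ ^ 2 + 1 / 2 * ∑ x ∈ S, ∑ y ∈ S, ‖K x y‖ * ‖v y‖ ^ 2 := by
        simp only [Finset.sum_add_distrib, Finset.mul_sum]
    _ ≤ 1 / 2 * (κ * ∑ x ∈ S, ‖v x‖ ^ 2) + 1 / 2 * (κ * ∑ x ∈ S, ‖v x‖ ^ 2) := by gcongr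
    _ = κ * ∑ x ∈ S, ‖v x‖ ^ 2 := by ring

/-- `‖v‖₂² ≦ |S|·sup‖v‖²` on a finite set: `Σ_{x∈S}‖v(x)‖² ≦ |S|·Φ²` when `‖v(x)‖ ≦ Φ` on `S`. [folklore] -/
private theorem sum_norm_sq_le_card_mul_sq {ι 𝕜 : Type*} [NormedField 𝕜] (S : Finset ι) (v : ι → 𝕜) {Φ : ℝ}
    (hv : ∀ x ∈ S, ‖v x‖ ≤ Φ) : ∑ x ∈ S, ‖v x‖ ^ 2 ≤ S.card * Φ ^ 2 := by
  calc ∑ x ∈ S, ‖v x‖ ^ 2 ≤ ∑ x ∈ S, Φ ^ 2 :=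
        Finset.sum_le_sum fun x hx => pow_le_pow_left₀ (norm_nonneg _) (hv x hx) 2
    _ = S.card * Φ ^ 2 := by rw [Finset.sum_const, nsmul_eq_mul]

/-- The difference of the two quadratic forms is the quadratic form of the kernel difference (bilinearity), the identity
behind *"σ is exact, «first order» is its bound"* (cell GAPS C-adv7-18 (c)). [folklore] -/
private theorem sum_sum_mul_sub_eq {ι 𝕜 : Type*} [NormedField 𝕜] (S : Finset ι) (v : ι → 𝕜) (K₀ K₁ : ι → ι → 𝕜) :
    (∑ x ∈ S, ∑ y ∈ S, v x * K₁ x y * v y) - ∑ x ∈ S, ∑ y ∈ S, v x * K₀ x y * v y =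
      ∑ x ∈ S, ∑ y ∈ S, v x * (K₁ x y - K₀ x y) * v y := by
  rw [← Finset.sum_sub_distrib]
  refine Finset.sum_congr rfl fun x _ => ?_
  rw [← Finset.sum_sub_distrib]
  exact Finset.sum_congr rfl fun y _ => by ring

/-- **p. 379 [25], the first inequality of the sentence DERIVED** (render p025, ll. 27–30): over the finite-kernel model
of the B-quadratic form of (1.71) — B-variables indexed by `S = (𝐁₀∖T₀) ∩ X` with `|S| ≦ |𝐁₀|` (`hS`), `‖B(b)‖ ≦
A₁p₁(g_k)` on the support of `χ′` ([IV] (1.82) p. 196 with `B′ = g_kB`, `δ′_k = g_kA₁p₁(g_k)`; `hB`), kernels `K₀` at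
the base point `(U,0)` and `K₁` at `(𝐔,𝐉)` whose difference has row sums `≦ C·B₃²·(α_{0,k} + α_{1,k})` (first order in
`A′, 𝐉`, two `H`-factors `≦ B₃`; `hK`), and `σ_Q` the exact difference of the two forms (`hσ`) — the printed bound
`|σ_Q| ≦ O(1)B₃²A₁²p₁²(g_k)|𝐁₀|(α_{0,k} + α_{1,k})` holds with the SAME `O(1) = C`, i.e. `SigmaQuad379 ‖σ_Q‖ C B₃ A₁
p₁(g_k) |𝐁₀| (α_{0,k}+α_{1,k})`. [cite: Balaban1989LargeFieldII, p.379 (after (1.72))] -/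
theorem sigmaQuad379_of_kernel {ι 𝕜 : Type*} [NormedField 𝕜] (S : Finset ι) (B : ι → 𝕜) (K₀ K₁ : ι → ι → 𝕜)
    {σQ : 𝕜} {C B₃ A₁ p₁g cardB₀ α : ℝ} (hC : 0 ≤ C) (hα : 0 ≤ α)
    (hB : ∀ b ∈ S, ‖B b‖ ≤ A₁ * p₁g) (hK : ∀ x ∈ S, ∑ y ∈ S, ‖K₁ x y - K₀ x y‖ ≤ C * B₃ ^ 2 * α)
    (hS : (S.card : ℝ) ≤ cardB₀)
    (hσ : σQ = (∑ x ∈ S, ∑ y ∈ S, B x * K₁ x y * B y) - ∑ x ∈ S, ∑ y ∈ S, B x * K₀ x y * B y) :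
    SigmaQuad379 ‖σQ‖ C B₃ A₁ p₁g cardB₀ α := by
  unfold SigmaQuad379
  rw [abs_norm, hσ, sum_sum_mul_sub_eq]
  have hκ : 0 ≤ C * B₃ ^ 2 * α := by positivity
  calc ‖∑ x ∈ S, ∑ y ∈ S, B x * (K₁ x y - K₀ x y) * B y‖
      ≤ (C * B₃ ^ 2 * α) * S.card * (A₁ * p₁g) ^ 2 :=
        norm_sum_sum_mul_le_of_rowSum S B (fun x y => K₁ x y - K₀ x y) hB hK
    _ ≤ (C * B₃ ^ 2 * α) * cardB₀ * (A₁ * p₁g) ^ 2 :=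
        mul_le_mul_of_nonneg_right (mul_le_mul_of_nonneg_left hS hκ) (sq_nonneg _)
    _ = C * B₃ ^ 2 * A₁ ^ 2 * p₁g ^ 2 * cardB₀ * α := by ring

/-- The same first inequality by the ℓ² road: Schur's test for the kernel difference (row AND column sums `≦
C·B₃²·(α_{0,k} + α_{1,k})`, `hrow`/`hcol`) bounds `‖σ_Q‖` by `C·B₃²(α_{0,k}+α_{1,k})·‖B‖₂²`, and `‖B‖₂² ≦ |S|·A₁²p₁²(g_k)
≦ |𝐁₀|·A₁²p₁²(g_k)` ([IV] (1.82); `hB`, `hS`). [cite: Balaban1989LargeFieldII, p.379 (after (1.72))] -/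
theorem sigmaQuad379_of_kernel_schur {ι 𝕜 : Type*} [NormedField 𝕜] (S : Finset ι) (B : ι → 𝕜)
    (K₀ K₁ : ι → ι → 𝕜) {σQ : 𝕜} {C B₃ A₁ p₁g cardB₀ α : ℝ} (hC : 0 ≤ C) (hα : 0 ≤ α)
    (hB : ∀ b ∈ S, ‖B b‖ ≤ A₁ * p₁g) (hrow : ∀ x ∈ S, ∑ y ∈ S, ‖K₁ x y - K₀ x y‖ ≤ C * B₃ ^ 2 * α)
    (hcol : ∀ y ∈ S, ∑ x ∈ S, ‖K₁ x y - K₀ x y‖ ≤ C * B₃ ^ 2 * α) (hS : (S.card : ℝ) ≤ cardB₀)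
    (hσ : σQ = (∑ x ∈ S, ∑ y ∈ S, B x * K₁ x y * B y) - ∑ x ∈ S, ∑ y ∈ S, B x * K₀ x y * B y) :
    SigmaQuad379 ‖σQ‖ C B₃ A₁ p₁g cardB₀ α := by
  unfold SigmaQuad379
  rw [abs_norm, hσ, sum_sum_mul_sub_eq]
  have hκ : 0 ≤ C * B₃ ^ 2 * α := by positivity
  calc ‖∑ x ∈ S, ∑ y ∈ S, B x * (K₁ x y - K₀ x y) * B y‖
      ≤ (C * B₃ ^ 2 * α) * ∑ x ∈ S, ‖B x‖ ^ 2 :=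
        norm_sum_sum_mul_le_of_schur S B (fun x y => K₁ x y - K₀ x y) hrow hcol
    _ ≤ (C * B₃ ^ 2 * α) * (S.card * (A₁ * p₁g) ^ 2) :=
        mul_le_mul_of_nonneg_left (sum_norm_sq_le_card_mul_sq S B hB) hκ
    _ ≤ (C * B₃ ^ 2 * α) * (cardB₀ * (A₁ * p₁g) ^ 2) :=
        mul_le_mul_of_nonneg_left (mul_le_mul_of_nonneg_right hS (sq_nonneg _)) hκ
    _ = C * B₃ ^ 2 * A₁ ^ 2 * p₁g ^ 2 * cardB₀ * α := by ring

/-- The whole printed chain for `σ_Q` over the finite-kernel model: the derived first inequality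
(`sigmaQuad379_of_kernel`) composed with §11's arithmetic of the second (`sigmaQuad379_arith`: `|𝐁₀| ≦ (100MR_k)^dN²`,
`N ≦ R_k`, `α_{0,k} + α_{1,k} ≦ C₀g_kq₀(g_k)`) gives *"≦ O(1)B₃²A₁²C₀M^dR_k^{d+2}p₁²(g_k)q₀(g_k)g_k"* with `O(1) = C·100^d`;
*"and this bound is small"* is `B16Sect1SmallFactors.sigmaQuad379_small`. [cite: Balaban1989LargeFieldII, p.379 (after (1.72))] -/
theorem sigmaQuad379_chain_of_kernel {ι 𝕜 : Type*} [NormedField 𝕜] (S : Finset ι) (B : ι → 𝕜)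
    (K₀ K₁ : ι → ι → 𝕜) {σQ : 𝕜} {C B₃ A₁ p₁g cardB₀ α C₀ M Rk gk q₀g : ℝ} {d N : ℕ} (hC : 0 ≤ C)
    (hα : 0 ≤ α) (hM : 0 ≤ M) (hRk : 0 ≤ Rk)
    (hB : ∀ b ∈ S, ‖B b‖ ≤ A₁ * p₁g) (hK : ∀ x ∈ S, ∑ y ∈ S, ‖K₁ x y - K₀ x y‖ ≤ C * B₃ ^ 2 * α)
    (hS : (S.card : ℝ) ≤ cardB₀)
    (hσ : σQ = (∑ x ∈ S, ∑ y ∈ S, B x * K₁ x y * B y) - ∑ x ∈ S, ∑ y ∈ S, B x * K₀ x y * B y)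
    (hB₀ : cardB₀ ≤ (100 * M * Rk) ^ d * (N : ℝ) ^ 2) (hN : B16Sect1Kernels.NWindowUpper N Rk)
    (hαC₀ : α ≤ C₀ * gk * q₀g) :
    ‖σQ‖ ≤ (C * 100 ^ d) * B₃ ^ 2 * A₁ ^ 2 * C₀ * M ^ d * Rk ^ (d + 2) * p₁g ^ 2 * q₀g * gk := by
  have h1 : SigmaQuad379 ‖σQ‖ C B₃ A₁ p₁g cardB₀ α := sigmaQuad379_of_kernel S B K₀ K₁ hC hα hB hK hS hσ
  unfold SigmaQuad379 at h1
  rw [abs_norm] at h1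
  exact h1.trans (sigmaQuad379_arith hC hM hRk hα hB₀ hN hαC₀)

end Literature.MathematicalPhysics.QuantumFieldTheory.Balaban1983to89.B16Sect1Statements
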